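import Mathlib
import HarnessLib.Audit
import Summits.PneNP.PneNP.Theorems.PstarChordBridgeBasis
import Summits.PneNP.PneNP.Theorems.PstarChordBridgeForest

/-!
# The (U2) corner: a single chord read in two directions (ROUND-24, memo §7 G4 / §9 O3; GAPTWO-PLAN S4)

FRONTIER range-avoidance ladder, rung F-N3, ROUND 24 (cell `pnp-ideate`, planner memo `r24/CORE-BOUND-NOTES.md` §7 G4 ("(U2) corner … needs its own
half page"), §9 O3 ("one-chord cores … a sub-system on `{e}` is already infeasible ⇒ non-minimal"); restricted-model proof complexity — nothing here
bears on `P` versus `NP`).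

`PstarChordBridgeBasis.regime_cases` leaves, besides the direction picture, the (U2) CORNER: the chord set is a single chord `N = {e₀}` whose two
privates are read in two INDEPENDENT constant directions `r = ρ_{e₀}`, `r' = ρ'_{e₀}` of `𝔽₂²`.  This file analyses that corner with the
forest-edge minimality of `PstarChordBridgeForest`:

* `decomp_V2` — `v = ω(v, r')·r + ω(v, r)·r'` for a basis `{r, r'}` of `𝔽₂²` (`ω` the symplectic pairing; `ω(v, m) = qDir`-coordinates);
* `u_eq_prod_of_corner` — **infeasibility is a FACTORISATION**: `u_{e₀} = q_{r'}·q_r + 1` on the whole cube, where `q_m = qDir I B m` is the basis-changed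
  constraint in direction `m` (the unique state hitting the target at `x` is `(q_{r'}(x), q_r(x))`, and it must be inadmissible);
* `corner_point` — **forest-edge minimality at a path edge `j ∈ D e₀`** produces a base point with `q_{r'}(x) = x_{p} + ω(τ_j, r')`,
  `q_r(x) = x_{q} + ω(τ_j, r)` and `x_p x_q = q_{r'}(x) q_r(x)`, where `τ_j = ([j ∈ T₁], [j ∈ T₂])` (`PstarChordBridgeForest.forest_minimality` +
  `defect_eq_one`);
* `omega_tau_of_polar` — the join pattern is dictated by the polar form: if `q_m` and an AND-sum `Q_D` (`D ⊆ J₀`) have the same polar form then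
  `ω(τ_j, m) = [j ∈ D]` for every forest edge `j` (simple overlaps; pendants off the core);
* `corner_not_const`, `corner_ne` — hence NEITHER factor is constant and the two factors are DISTINCT: a constant factor `q_r ≡ κ` forces `κ = 1`,
  `q_{r'} = Q_{D e₀} + γ + 1`, joins `ω(τ_j, r) = 0`, `ω(τ_j, r') = 1` on the path, and then the corner point gives `x_p = x_p + 1`; equal factors
  force `ω(τ_j, r) = ω(τ_j, r') = 1` and the corner point gives the same contradiction.

So a (U2) core carries a NON-TRIVIAL FACTORISATION `Q_{D e₀} + γ + 1 = q_{r'}·q_r` into two distinct non-constant quadratics — by rank rigidity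
(`PstarRankRigidity`) this is the pure-elliptic rank-`4` object of the (EXC) case; its elimination is left with (EXC).
-/

set_option linter.dupNamespace false -- `Summit.PneNP.PneNP.…`: summit = sub-problem name (D-0017 single-conjunct layout)

open Finset Module Literature.Computability.Complexity
open Summit.PneNP.PneNP.Theorems.PstarFibrePolys (bit)
open Summit.PneNP.PneNP.Theorems.PstarTyped (Typed)
open Summit.PneNP.PneNP.Theorems.PstarSALevel (varSet bdry BoundaryExpanding SimpleOverlap)
open Summit.PneNP.PneNP.Theorems.PstarGapOneAll (gval)
open Summit.PneNP.PneNP.Theorems.PstarProductRank (qform polar)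
open Summit.PneNP.PneNP.Theorems.PstarPathRank (AndAdj polar_basis andPair_ne)
open Summit.PneNP.PneNP.Theorems.PstarForcing (polar_unique exists_ne_of_rank_four)
open Summit.PneNP.PneNP.Theorems.PstarReadSumset (V2)
open Summit.PneNP.PneNP.Theorems.PstarChordSystem (ChordSystem)
open Summit.PneNP.PneNP.Theorems.PstarChordSystemMap (omega)
open Summit.PneNP.PneNP.Theorems.PstarChordBridgeTools
open Summit.PneNP.PneNP.Theorems.PstarChordBridge
open Summit.PneNP.PneNP.Theorems.PstarChordBridgeForcing
open Summit.PneNP.PneNP.Theorems.PstarChordBridgeBasis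
open Summit.PneNP.PneNP.Theorems.PstarChordBridgeForest (forest_minimality defect_eq_one)

namespace Summit.PneNP.PneNP.Theorems.PstarChordBridgeCorner

variable {n m : ℕ}

/-! ## Coordinates in a basis of `𝔽₂²` -/

/-- **Decomposition in the basis `{r, r'}`**: `v = ω(v, r')·r + ω(v, r)·r'` for distinct non-zero `r, r'`. -/
theorem decomp_V2 {r r' : V2} (hr : r ≠ 0) (hr' : r' ≠ 0) (hne : r ≠ r') (v : V2) : v = omega v r' • r + omega v r • r' := by
  unfold omega
  obtain ⟨a, b⟩ := r
  obtain ⟨c, d⟩ := r'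
  obtain ⟨v₁, v₂⟩ := v
  revert a b c d v₁ v₂
  decide

/-- `ω(·, m)` of the state-free value is the basis-changed constraint `qDir`. -/
theorem omega_F (I : LocalMap 4 n m) (B : BridgeData n m) (mv : V2) (x : Fin n → ZMod 2) :
    omega ((sys I B).F x + (sys I B).t) mv = qDir I B mv x := by
  unfold omega qDir
  rw [sys_F, sys_t]
  simp only [Prod.fst_add, Prod.snd_add]
  ring

/-- `ω` is additive in the first argument. -/
theorem omega_add_left (v w mv : V2) : omega (v + w) mv = omega v mv + omega w mv := by
  unfold omega; simp only [Prod.fst_add, Prod.snd_add]; ring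

/-- `ω` is alternating and pairs distinct non-zero vectors to `1`. -/
theorem omega_basis {r r' : V2} (hr : r ≠ 0) (hr' : r' ≠ 0) (hne : r ≠ r') :
    omega r r = 0 ∧ omega r' r' = 0 ∧ omega r r' = 1 ∧ omega r' r = 1 := by
  unfold omega
  obtain ⟨a, b⟩ := r
  obtain ⟨c, d⟩ := r'
  revert a b c d
  decide

/-- `ω(c • v, m) = c · ω(v, m)`. -/
theorem omega_smul (c : ZMod 2) (v mv : V2) : omega (c • v) mv = c * omega v mv := by
  unfold omega; simp only [Prod.smul_fst, Prod.smul_snd, smul_eq_mul]; ring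

/-! ## Infeasibility is a factorisation -/

/-- The value of the single-chord system. -/
theorem val_singleton (I : LocalMap 4 n m) (B : BridgeData n m) {e₀ : Fin m} (x : Fin n → ZMod 2) (s : Fin m → ZMod 2 × ZMod 2) :
    (sys I B).val {e₀} x s = (sys I B).F x + ((s e₀).1 • (sys I B).ρ e₀ x + (s e₀).2 • (sys I B).ρ' e₀ x) := by
  unfold ChordSystem.val ChordSystem.contrib
  rw [sum_singleton]

/-- **Infeasibility of the (U2) corner is a factorisation**: with the chord set `{e₀}` read in the constant independent directions `r, r'`, an
infeasible system has `u_{e₀}(x) = q_{r'}(x)·q_r(x) + 1` at every base point. -/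
theorem u_eq_prod_of_corner (I : LocalMap 4 n m) (B : BridgeData n m) {e₀ : Fin m} {r r' : V2} (hr : r ≠ 0) (hr' : r' ≠ 0) (hne : r ≠ r')
    (hρ : ∀ x, (sys I B).ρ e₀ x = r) (hρ' : ∀ x, (sys I B).ρ' e₀ x = r') (hinf : (sys I B).Infeasible {e₀}) (x : Fin n → ZMod 2) :
    (sys I B).u e₀ x = qDir I B r' x * qDir I B r x + 1 := by
  -- the state `(q_{r'}(x), q_r(x))` hits the target; it must be inadmissible
  have hhit : (sys I B).val {e₀} x (fun _ => (qDir I B r' x, qDir I B r x)) = (sys I B).t := by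
    rw [val_singleton, hρ, hρ']
    have hd := decomp_V2 hr hr' hne ((sys I B).F x + (sys I B).t)
    rw [omega_F, omega_F] at hd
    have e2 : ∀ F T w : V2, F + T = w → F + w = T := by
      intro F T w h; rw [← h, ← add_assoc, PstarReadSumset.add_self, zero_add]
    exact e2 _ _ _ hd
  have hnadm : ¬ (sys I B).Adm {e₀} x (fun _ => (qDir I B r' x, qDir I B r x)) := fun hadm => hinf x _ hadm hhit
  unfold ChordSystem.Adm at hnadm
  push Not at hnadm
  obtain ⟨e, he, hne'⟩ := hnadm
  rw [mem_singleton] at he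
  subst he
  simp only at hne'
  have key : ∀ a b u : ZMod 2, a * b ≠ u → u = a * b + 1 := by decide
  exact key _ _ _ hne'

/-! ## The corner point supplied by forest-edge minimality -/

/-- **The corner point.**  In the (U2) corner (`N = {e₀}`, constant independent reads `r, r'`, no pendant reading the privates of `e₀`), a solution
of `(J₀ − j) ∧ Γ₁ ∧ Γ₂` for a path edge `j ∈ D e₀`, with the whole system unsolvable, gives a base point `x` with
`q_{r'}(x) = x_p + ω(τ_j, r')`, `q_r(x) = x_q + ω(τ_j, r)` and `x_p x_q = u_{e₀}(x) + 1`, where `τ_j = ([j ∈ T₁], [j ∈ T₂])`. -/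
theorem corner_point (I : LocalMap 4 n m) (hI : I.IsPure xorAndPred) (hT : Typed I) {B : BridgeData n m} (hW : B.WF I) {e₀ j : Fin m}
    (hN : B.N = {e₀}) (hj : j ∈ B.D e₀) {r r' : V2} (hr : r ≠ 0) (hr' : r' ≠ 0) (hne : r ≠ r')
    (hρ : ∀ x, (sys I B).ρ e₀ x = r) (hρ' : ∀ x, (sys I B).ρ' e₀ x = r')
    (hG₁ : ∀ g ∈ B.G₁, I.vars g 2 ≠ I.vars e₀ 2 ∧ I.vars g 2 ≠ I.vars e₀ 3 ∧ I.vars g 3 ≠ I.vars e₀ 2 ∧ I.vars g 3 ≠ I.vars e₀ 3)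
    (hG₂ : ∀ g ∈ B.G₂, I.vars g 2 ≠ I.vars e₀ 2 ∧ I.vars g 2 ≠ I.vars e₀ 3 ∧ I.vars g 3 ≠ I.vars e₀ 2 ∧ I.vars g 3 ≠ I.vars e₀ 3)
    (hT3 : ¬ ∃ z, Solution I B B.J₀ z) {z : Fin n → Bool} (hz : Solution I B (B.J₀.erase j) z) :
    qDir I B r' (fun v => bit (z v)) = bit (z (I.vars e₀ 2)) + omega ((if j ∈ B.T₁ then 1 else 0), (if j ∈ B.T₂ then 1 else 0)) r' ∧
    qDir I B r (fun v => bit (z v)) = bit (z (I.vars e₀ 3)) + omega ((if j ∈ B.T₁ then 1 else 0), (if j ∈ B.T₂ then 1 else 0)) r ∧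
    bit (z (I.vars e₀ 2)) * bit (z (I.vars e₀ 3)) = (sys I B).u e₀ (fun v => bit (z v)) + 1 := by
  have he₀ : e₀ ∈ B.N := by rw [hN]; exact mem_singleton_self e₀
  obtain ⟨-, hval⟩ := forest_minimality I hI hT hW he₀ hj hG₁ hG₂ hz
  have hδ := defect_eq_one I hI hW he₀ hj hT3 hz
  set x : Fin n → ZMod 2 := fun v => bit (z v) with hx
  -- the defect is `1`: the correction vector is `τ_j`
  rw [hN, val_singleton, hρ, hρ', hδ] at hval
  have hd : (sys I B).F x + (sys I B).t =
      bit (z (I.vars e₀ 2)) • r + bit (z (I.vars e₀ 3)) • r' + ((if j ∈ B.T₁ then 1 else 0), (if j ∈ B.T₂ then 1 else 0)) := by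
    have e2 : ∀ F T a τ : V2, F + a = T + τ → F + T = a + τ := by decide
    exact e2 _ _ _ _ hval
  obtain ⟨hrr, hr'r', hrr', hr'r⟩ := omega_basis hr hr' hne
  refine ⟨?_, ?_, ?_⟩
  · rw [← omega_F, hd, omega_add_left, omega_add_left, omega_smul, omega_smul, hrr', hr'r', mul_one, mul_zero, add_zero]
  · rw [← omega_F, hd, omega_add_left, omega_add_left, omega_smul, omega_smul, hrr, hr'r, mul_zero, mul_one, zero_add]
  · have key : ∀ u p : ZMod 2, u + p = 1 → p = u + 1 := by decide
    exact key _ _ hδ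

/-! ## The join pattern is dictated by the polar form -/

/-- On an instance with simple overlaps, an output is AND-adjacent to a family iff it belongs to it. -/
theorem andAdj_iff_mem (I : LocalMap 4 n m) (hI : I.IsPure xorAndPred) (hS : SimpleOverlap I) (X : Finset (Fin m)) (j : Fin m) :
    AndAdj I X (I.vars j 2) (I.vars j 3) ↔ j ∈ X := by
  constructor
  · rintro ⟨j', hj', h⟩
    by_cases hjj : j = j'
    · rw [hjj]; exact hj'
    · exfalso
      refine andPair_ne I hI hS hjj ?_
      rcases h with ⟨h2, h3⟩ | ⟨h2, h3⟩
      · exact Or.inl ⟨h2.symm, h3.symm⟩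
      · exact Or.inr ⟨h3.symm, h2.symm⟩
  · intro hj
    exact ⟨j, hj, Or.inl ⟨rfl, rfl⟩⟩

/-- `qDir` satisfies the polar identity with `polarDir`. -/
theorem qDir_add (I : LocalMap 4 n m) (B : BridgeData n m) (mv : V2) (x w : Fin n → ZMod 2) :
    qDir I B mv (x + w) = qDir I B mv x + qDir I B mv w + qDir I B mv 0 + polarDir I B mv x w := by
  have h := q_dir_add I B mv x w
  simp only [q_dir] at h
  exact h

/-- **The join pattern from the polar form.**  If `polarDir m` is the polar form of the AND-sum of a family `D`, then for every output `j` of the core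
(pendants off the core) `m₂·[j ∈ T₁] + m₁·[j ∈ T₂] = [j ∈ D]`, i.e. `ω(τ_j, m) = [j ∈ D]`. -/
theorem omega_tau_of_polar (I : LocalMap 4 n m) (hI : I.IsPure xorAndPred) (hS : SimpleOverlap I) (B : BridgeData n m)
    (hG₁ : Disjoint B.J₀ B.G₁) (hG₂ : Disjoint B.J₀ B.G₂) {mv : V2} {D : Finset (Fin m)}
    (hpol : polarDir I B mv = polar D (fun j => I.vars j 2) (fun j => I.vars j 3)) {j : Fin m} (hj : j ∈ B.J₀) :
    omega ((if j ∈ B.T₁ then 1 else 0), (if j ∈ B.T₂ then 1 else 0)) mv = if j ∈ D then (1 : ZMod 2) else 0 := by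
  classical
  have h := congrArg (fun P : LinearMap.BilinForm (ZMod 2) (Fin n → ZMod 2) => P (Pi.single (I.vars j 2) 1) (Pi.single (I.vars j 3) 1)) hpol
  simp only [polarDir, freePolar, LinearMap.add_apply, LinearMap.smul_apply, smul_eq_mul, polar_basis I hI hS, andAdj_iff_mem I hI hS] at h
  have hjG₁ : j ∉ freeMon I B.N B.G₁ := fun h' => disjoint_left.1 hG₁ hj (mem_filter.1 h').1
  have hjG₂ : j ∉ freeMon I B.N B.G₂ := fun h' => disjoint_left.1 hG₂ hj (mem_filter.1 h').1
  rw [if_neg hjG₁, if_neg hjG₂, add_zero, add_zero] at h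
  unfold omega
  rw [← h]
  ring

/-! ## Neither factor is constant, and the factors differ -/

/-- The polar form of the empty family vanishes. -/
theorem polar_empty (I : LocalMap 4 n m) : polar (∅ : Finset (Fin m)) (fun j => I.vars j 2) (fun j => I.vars j 3) = (0 : LinearMap.BilinForm (ZMod 2) (Fin n → ZMod 2)) := by
  refine LinearMap.ext₂ fun x w => ?_
  rw [PstarProductRank.polar_apply, sum_empty]
  rfl

/-- **In the (U2) corner no factor is constant**: `q_r ≡ κ` is impossible. -/
theorem corner_not_const (I : LocalMap 4 n m) (hI : I.IsPure xorAndPred) (hT : Typed I) (hS : SimpleOverlap I) {r₀ : ℕ}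
    (hB : BoundaryExpanding r₀ I) {B : BridgeData n m} (hW : B.WF I) (hcard : B.J₀.card ≤ r₀) (hG₁ : Disjoint B.J₀ B.G₁) (hG₂ : Disjoint B.J₀ B.G₂)
    {e₀ : Fin m} (hN : B.N = {e₀}) {r r' : V2} (hr : r ≠ 0) (hr' : r' ≠ 0) (hne : r ≠ r')
    (hρ : ∀ x, (sys I B).ρ e₀ x = r) (hρ' : ∀ x, (sys I B).ρ' e₀ x = r')
    (hG₁' : ∀ g ∈ B.G₁, I.vars g 2 ≠ I.vars e₀ 2 ∧ I.vars g 2 ≠ I.vars e₀ 3 ∧ I.vars g 3 ≠ I.vars e₀ 2 ∧ I.vars g 3 ≠ I.vars e₀ 3)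
    (hG₂' : ∀ g ∈ B.G₂, I.vars g 2 ≠ I.vars e₀ 2 ∧ I.vars g 2 ≠ I.vars e₀ 3 ∧ I.vars g 3 ≠ I.vars e₀ 2 ∧ I.vars g 3 ≠ I.vars e₀ 3)
    (hinf : (sys I B).Infeasible B.N) (hT3 : ¬ ∃ z, Solution I B B.J₀ z) (hM0 : ∀ j ∈ B.D e₀, ∃ z, Solution I B (B.J₀.erase j) z)
    {κ : ZMod 2} (hκ : ∀ x, qDir I B r x = κ) : False := by
  classical
  have he₀ : e₀ ∈ B.N := by rw [hN]; exact mem_singleton_self e₀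
  have hinf' : (sys I B).Infeasible {e₀} := by rw [← hN]; exact hinf
  have hu := u_eq_prod_of_corner I B hr hr' hne hρ hρ' hinf'
  have hrank := rank_four_of_wf I hI hS hB hW hcard he₀
  -- `κ = 1`, else `u_{e₀}` would be constant
  have hκ1 : κ = 1 := by
    by_contra h0
    have hκ0 : κ = 0 := by revert h0; generalize κ = t; revert t; decide
    obtain ⟨v, hv⟩ := exists_ne_of_rank_four (qform_add' I (B.D e₀)) hrank
    have h1 := hu v
    have h2 := hu 0
    rw [hκ, hκ0, mul_zero, zero_add, sys_u_eq] at h1 h2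
    apply hv
    have key : ∀ g a b : ZMod 2, g + a = 1 → g + b = 1 → a = b := by decide
    exact key _ _ _ h1 h2
  subst hκ1
  -- so `q_{r'} = Q_{D e₀} + γ + 1`: polar forms agree, and `q_r ≡ 1` has polar form `0`
  have hu' : ∀ x, qDir I B r' x = gam B e₀ + qform (B.D e₀) (fun j => I.vars j 2) (fun j => I.vars j 3) x + 1 := fun x => by
    have h := hu x
    rw [hκ, mul_one, sys_u_eq] at h
    have key : ∀ s q : ZMod 2, s = q + 1 → q = s + 1 := by decide
    exact key _ _ h
  have hpol' : polarDir I B r' = polar (B.D e₀) (fun j => I.vars j 2) (fun j => I.vars j 3) := by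
    refine polar_unique (Q := qDir I B r') (qDir_add I B r') fun x w => ?_
    rw [hu', hu', hu', hu', qform_add' I (B.D e₀) x w]
    generalize gam B e₀ = g
    generalize qform (B.D e₀) (fun j => I.vars j 2) (fun j => I.vars j 3) x = a
    generalize qform (B.D e₀) (fun j => I.vars j 2) (fun j => I.vars j 3) w = b
    generalize qform (B.D e₀) (fun j => I.vars j 2) (fun j => I.vars j 3) (0 : Fin n → ZMod 2) = c
    generalize polar (B.D e₀) (fun j => I.vars j 2) (fun j => I.vars j 3) x w = d
    revert g a b c d; decide
  have hpol : polarDir I B r = polar (∅ : Finset (Fin m)) (fun j => I.vars j 2) (fun j => I.vars j 3) := by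
    rw [polar_empty]
    refine polar_unique (Q := qDir I B r) (qDir_add I B r) fun x w => ?_
    rw [hκ, hκ, hκ, hκ, LinearMap.zero_apply, LinearMap.zero_apply]; decide
  -- a path edge and its corner point
  have heD : e₀ ∉ B.D e₀ := fun h => (mem_sdiff.1 (hW.hD e₀ he₀ h)).2 he₀
  have h2 := PstarChordBridgeFundamental.two_le_card_of_even I hI hS heD (hW.hDeven e₀ he₀)
  obtain ⟨j, hj⟩ : (B.D e₀).Nonempty := card_pos.1 (by omega)
  have hjJ : j ∈ B.J₀ := (mem_sdiff.1 (hW.hD e₀ he₀ hj)).1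
  obtain ⟨z, hz⟩ := hM0 j hj
  obtain ⟨hq', hq, hpq⟩ := corner_point I hI hT hW hN hj hr hr' hne hρ hρ' hG₁' hG₂' hT3 hz
  rw [omega_tau_of_polar I hI hS B hG₁ hG₂ hpol' hjJ, if_pos hj] at hq'
  rw [omega_tau_of_polar I hI hS B hG₁ hG₂ hpol hjJ, if_neg (notMem_empty j), add_zero, hκ] at hq
  rw [hu, hκ, mul_one, hq'] at hpq
  rw [← hq] at hpq
  have key : ∀ p : ZMod 2, p * 1 = p + 1 + 1 + 1 → False := by decide
  exact key _ hpq

/-- **In the (U2) corner the two factors differ**: `q_r = q_{r'}` is impossible. -/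
theorem corner_ne (I : LocalMap 4 n m) (hI : I.IsPure xorAndPred) (hT : Typed I) (hS : SimpleOverlap I)
    {B : BridgeData n m} (hW : B.WF I) (hG₁ : Disjoint B.J₀ B.G₁) (hG₂ : Disjoint B.J₀ B.G₂)
    {e₀ : Fin m} (hN : B.N = {e₀}) {r r' : V2} (hr : r ≠ 0) (hr' : r' ≠ 0) (hne : r ≠ r')
    (hρ : ∀ x, (sys I B).ρ e₀ x = r) (hρ' : ∀ x, (sys I B).ρ' e₀ x = r')
    (hG₁' : ∀ g ∈ B.G₁, I.vars g 2 ≠ I.vars e₀ 2 ∧ I.vars g 2 ≠ I.vars e₀ 3 ∧ I.vars g 3 ≠ I.vars e₀ 2 ∧ I.vars g 3 ≠ I.vars e₀ 3)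
    (hG₂' : ∀ g ∈ B.G₂, I.vars g 2 ≠ I.vars e₀ 2 ∧ I.vars g 2 ≠ I.vars e₀ 3 ∧ I.vars g 3 ≠ I.vars e₀ 2 ∧ I.vars g 3 ≠ I.vars e₀ 3)
    (hinf : (sys I B).Infeasible B.N) (hT3 : ¬ ∃ z, Solution I B B.J₀ z) (hM0 : ∀ j ∈ B.D e₀, ∃ z, Solution I B (B.J₀.erase j) z)
    (heq : ∀ x, qDir I B r x = qDir I B r' x) : False := by
  classical
  have he₀ : e₀ ∈ B.N := by rw [hN]; exact mem_singleton_self e₀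
  have hinf' : (sys I B).Infeasible {e₀} := by rw [← hN]; exact hinf
  have hu := u_eq_prod_of_corner I B hr hr' hne hρ hρ' hinf'
  -- `u = w·w + 1 = w + 1` with `w = q_r = q_{r'}`
  have hu' : ∀ x, qDir I B r' x = gam B e₀ + qform (B.D e₀) (fun j => I.vars j 2) (fun j => I.vars j 3) x + 1 := fun x => by
    have h := hu x
    rw [heq, sys_u_eq] at h
    have key : ∀ s q : ZMod 2, s = q * q + 1 → q = s + 1 := by decide
    exact key _ _ h
  have hpol' : polarDir I B r' = polar (B.D e₀) (fun j => I.vars j 2) (fun j => I.vars j 3) := by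
    refine polar_unique (Q := qDir I B r') (qDir_add I B r') fun x w => ?_
    rw [hu', hu', hu', hu', qform_add' I (B.D e₀) x w]
    generalize gam B e₀ = g
    generalize qform (B.D e₀) (fun j => I.vars j 2) (fun j => I.vars j 3) x = a
    generalize qform (B.D e₀) (fun j => I.vars j 2) (fun j => I.vars j 3) w = b
    generalize qform (B.D e₀) (fun j => I.vars j 2) (fun j => I.vars j 3) (0 : Fin n → ZMod 2) = c
    generalize polar (B.D e₀) (fun j => I.vars j 2) (fun j => I.vars j 3) x w = d
    revert g a b c d; decide
  have hpol : polarDir I B r = polar (B.D e₀) (fun j => I.vars j 2) (fun j => I.vars j 3) := by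
    refine polar_unique (Q := qDir I B r) (qDir_add I B r) fun x w => ?_
    rw [heq, heq, heq, heq, hu', hu', hu', hu', qform_add' I (B.D e₀) x w]
    generalize gam B e₀ = g
    generalize qform (B.D e₀) (fun j => I.vars j 2) (fun j => I.vars j 3) x = a
    generalize qform (B.D e₀) (fun j => I.vars j 2) (fun j => I.vars j 3) w = b
    generalize qform (B.D e₀) (fun j => I.vars j 2) (fun j => I.vars j 3) (0 : Fin n → ZMod 2) = c
    generalize polar (B.D e₀) (fun j => I.vars j 2) (fun j => I.vars j 3) x w = d
    revert g a b c d; decide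
  have heD : e₀ ∉ B.D e₀ := fun h => (mem_sdiff.1 (hW.hD e₀ he₀ h)).2 he₀
  have h2 := PstarChordBridgeFundamental.two_le_card_of_even I hI hS heD (hW.hDeven e₀ he₀)
  obtain ⟨j, hj⟩ : (B.D e₀).Nonempty := card_pos.1 (by omega)
  have hjJ : j ∈ B.J₀ := (mem_sdiff.1 (hW.hD e₀ he₀ hj)).1
  obtain ⟨z, hz⟩ := hM0 j hj
  obtain ⟨hq', hq, hpq⟩ := corner_point I hI hT hW hN hj hr hr' hne hρ hρ' hG₁' hG₂' hT3 hz
  rw [omega_tau_of_polar I hI hS B hG₁ hG₂ hpol' hjJ, if_pos hj] at hq'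
  rw [omega_tau_of_polar I hI hS B hG₁ hG₂ hpol hjJ, if_pos hj] at hq
  -- `q_r = q_{r'}` at the corner point: `x_q + 1 = x_p + 1`; and `x_p x_q = q_{r'} q_r = (x_p + 1)(x_q + 1)`
  have hpq' : bit (z (I.vars e₀ 2)) = bit (z (I.vars e₀ 3)) := by
    have h := heq (fun v => bit (z v))
    rw [hq, hq'] at h
    have key : ∀ p q : ZMod 2, q + 1 = p + 1 → p = q := by decide
    exact key _ _ h
  rw [hu, hq', hq, hpq'] at hpq
  have key : ∀ q : ZMod 2, q * q = (q + 1) * (q + 1) + 1 + 1 → False := by decide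
  exact key _ hpq

/-- **Summary: a (U2) core carries a non-trivial factorisation of its chord's fundamental form.**  `u_{e₀} = q_{r'}·q_r + 1` with both factors
non-constant and distinct (the (EXC)/pure-elliptic object of the line; memo O3 is thereby reduced to the (EXC) analysis). -/
theorem corner_factorisation (I : LocalMap 4 n m) (hI : I.IsPure xorAndPred) (hT : Typed I) (hS : SimpleOverlap I) {r₀ : ℕ}
    (hB : BoundaryExpanding r₀ I) {B : BridgeData n m} (hW : B.WF I) (hcard : B.J₀.card ≤ r₀) (hG₁ : Disjoint B.J₀ B.G₁) (hG₂ : Disjoint B.J₀ B.G₂)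
    {e₀ : Fin m} (hN : B.N = {e₀}) {r r' : V2} (hr : r ≠ 0) (hr' : r' ≠ 0) (hne : r ≠ r')
    (hρ : ∀ x, (sys I B).ρ e₀ x = r) (hρ' : ∀ x, (sys I B).ρ' e₀ x = r')
    (hG₁' : ∀ g ∈ B.G₁, I.vars g 2 ≠ I.vars e₀ 2 ∧ I.vars g 2 ≠ I.vars e₀ 3 ∧ I.vars g 3 ≠ I.vars e₀ 2 ∧ I.vars g 3 ≠ I.vars e₀ 3)
    (hG₂' : ∀ g ∈ B.G₂, I.vars g 2 ≠ I.vars e₀ 2 ∧ I.vars g 2 ≠ I.vars e₀ 3 ∧ I.vars g 3 ≠ I.vars e₀ 2 ∧ I.vars g 3 ≠ I.vars e₀ 3)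
    (hinf : (sys I B).Infeasible B.N) (hT3 : ¬ ∃ z, Solution I B B.J₀ z) (hM0 : ∀ j ∈ B.D e₀, ∃ z, Solution I B (B.J₀.erase j) z) :
    (∀ x, (sys I B).u e₀ x = qDir I B r' x * qDir I B r x + 1) ∧
    (¬ ∃ κ, ∀ x, qDir I B r x = κ) ∧ (¬ ∃ κ, ∀ x, qDir I B r' x = κ) ∧ ¬ (∀ x, qDir I B r x = qDir I B r' x) := by
  have hinf' : (sys I B).Infeasible {e₀} := by rw [← hN]; exact hinf
  refine ⟨u_eq_prod_of_corner I B hr hr' hne hρ hρ' hinf', fun ⟨κ, hκ⟩ => ?_, fun ⟨κ, hκ⟩ => ?_, fun heq => ?_⟩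
  · exact corner_not_const I hI hT hS hB hW hcard hG₁ hG₂ hN hr hr' hne hρ hρ' hG₁' hG₂' hinf hT3 hM0 hκ
  · -- symmetric: swap the roles of the two privates by swapping `r ↔ r'`?  The factorisation is symmetric, but the corner point is not;
    -- we rerun the constant-factor argument with `q_{r'} ≡ κ`.
    classical
    have he₀ : e₀ ∈ B.N := by rw [hN]; exact mem_singleton_self e₀
    have hu := u_eq_prod_of_corner I B hr hr' hne hρ hρ' hinf'
    have hrank := rank_four_of_wf I hI hS hB hW hcard he₀
    have hκ1 : κ = 1 := by
      by_contra h0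
      have hκ0 : κ = 0 := by revert h0; generalize κ = t; revert t; decide
      obtain ⟨v, hv⟩ := exists_ne_of_rank_four (qform_add' I (B.D e₀)) hrank
      have h1 := hu v
      have h2 := hu 0
      rw [hκ, hκ0, zero_mul, zero_add, sys_u_eq] at h1 h2
      apply hv
      have key : ∀ g a b : ZMod 2, g + a = 1 → g + b = 1 → a = b := by decide
      exact key _ _ _ h1 h2
    subst hκ1
    have hu' : ∀ x, qDir I B r x = gam B e₀ + qform (B.D e₀) (fun j => I.vars j 2) (fun j => I.vars j 3) x + 1 := fun x => by
      have h := hu x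
      rw [hκ, one_mul, sys_u_eq] at h
      have key : ∀ s q : ZMod 2, s = q + 1 → q = s + 1 := by decide
      exact key _ _ h
    have hpol : polarDir I B r = polar (B.D e₀) (fun j => I.vars j 2) (fun j => I.vars j 3) := by
      refine polar_unique (Q := qDir I B r) (qDir_add I B r) fun x w => ?_
      rw [hu', hu', hu', hu', qform_add' I (B.D e₀) x w]
      generalize gam B e₀ = g
      generalize qform (B.D e₀) (fun j => I.vars j 2) (fun j => I.vars j 3) x = a
      generalize qform (B.D e₀) (fun j => I.vars j 2) (fun j => I.vars j 3) w = b
      generalize qform (B.D e₀) (fun j => I.vars j 2) (fun j => I.vars j 3) (0 : Fin n → ZMod 2) = c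
      generalize polar (B.D e₀) (fun j => I.vars j 2) (fun j => I.vars j 3) x w = d
      revert g a b c d; decide
    have hpol' : polarDir I B r' = polar (∅ : Finset (Fin m)) (fun j => I.vars j 2) (fun j => I.vars j 3) := by
      rw [polar_empty]
      refine polar_unique (Q := qDir I B r') (qDir_add I B r') fun x w => ?_
      rw [hκ, hκ, hκ, hκ, LinearMap.zero_apply, LinearMap.zero_apply]; decide
    have heD : e₀ ∉ B.D e₀ := fun h => (mem_sdiff.1 (hW.hD e₀ he₀ h)).2 he₀
    have h2 := PstarChordBridgeFundamental.two_le_card_of_even I hI hS heD (hW.hDeven e₀ he₀)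
    obtain ⟨j, hj⟩ : (B.D e₀).Nonempty := card_pos.1 (by omega)
    have hjJ : j ∈ B.J₀ := (mem_sdiff.1 (hW.hD e₀ he₀ hj)).1
    obtain ⟨z, hz⟩ := hM0 j hj
    obtain ⟨hq', hq, hpq⟩ := corner_point I hI hT hW hN hj hr hr' hne hρ hρ' hG₁' hG₂' hT3 hz
    rw [omega_tau_of_polar I hI hS B hG₁ hG₂ hpol' hjJ, if_neg (notMem_empty j), add_zero, hκ] at hq'
    rw [omega_tau_of_polar I hI hS B hG₁ hG₂ hpol hjJ, if_pos hj] at hq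
    rw [hu, hκ, one_mul, hq] at hpq
    rw [← hq'] at hpq
    have key : ∀ q : ZMod 2, 1 * q = q + 1 + 1 + 1 → False := by decide
    exact key _ hpq
  · exact corner_ne I hI hT hS hW hG₁ hG₂ hN hr hr' hne hρ hρ' hG₁' hG₂' hinf hT3 hM0 heq

end Summit.PneNP.PneNP.Theorems.PstarChordBridgeCorner
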